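import Summits.QuantumFields.BalabanUV.Beta.CovariantTowerRemainder

/-!
# Beta / CovariantTowerParametrix — THM 3.7-SHAPE IN ℓ² FOR THE k-FOLD COVARIANT TOWER OPERATOR, MODULO THE OVERLAP
# NUMBERS OF THE PARTITION OF UNITY: an abstract FINITE-OVERLAP lemma ‖Σ_z S_z‖ ≤ C·√(νν₀), the ℓ² inverse of 1 − R′ for
# ‖R′‖ ≤ q < 1, and the assembly G′ = G′₀(1 − R′)⁻¹, ‖G′‖ ≤ ‖G′₀‖/(1 − q) from pv21's parametrix identity and
# `CovariantTowerRemainder.remainderTerm_le_torus_top`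
# (unit `b2b-balaban-beta-d4-p2`, GEN 4; node (m1) of `beta/skeletons/D4-NODE-O2-b2b-balaban-beta-d4-p2.md`, assembly)

HONEST FRAMING: discharging `BetaPertH` makes Bałaban's UV stability UNCONDITIONAL — NOT the continuum limit, NOT the
Clay problem.  HONEST DEPENDENCY (verbatim): «continuum YM on T⁴ ⇐ BetaPertH ∧ nine spine estimates (0/9 proved);
BetaPertH ⇐ (D1) ∧ (D4) ∧ CAP+tail; G-an2-4 gates asym, D1 and NE2/3/4.»  THIS MODULE DISCHARGES NOTHING of `BetaPertH`,
asserts NOTHING printed and cites nothing as a fact (ABSOLUTE RULE): [folklore] finite-dimensional linear algebra about the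
component MODEL of the pv21 chain ([B9] = `Balaban1985BackgroundPropagators`, Commun. Math. Phys. 99 (1985) 389–434;
SHAPES: (3.87)–(3.90) p. 409 — G′ = G′₀ + G′R′, R′ = Σ_□K(h_□)G′_□h_□ «and for M sufficiently large … the series converges»,
Thm 3.7).

CONTENT (`L2Bound` of `CovariantTowerL2`).
* §1 **`l2Bound_sum_of_overlap`** (abstract almost-orthogonality): a finite family S_z of endomorphisms of the fields, each
  reading only a region In(z) (S_z = S_z∘M_{χ_in z}), writing only a region Out(z), with ‖S_z‖ ≤ C, and every point lying in
  at most ν₀ input regions and ν output regions ⇒ ‖Σ_z S_z‖ ≤ C√(νν₀).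
* §2 **`isUnit_one_sub`**, **`l2Bound_inverse_one_sub`**: ‖R‖ ≤ q < 1 ⇒ 1 − R is a unit and ‖(1 − R)⁻¹‖ ≤ (1 − q)⁻¹ (no
  series: injectivity in finite dimension + the a-priori bound ‖w‖ ≤ ‖v‖ + q‖w‖).
* §3 **`parametrix_l2`**: G′ = G′₀ + G′R′ (the (3.90) shape, pv21 `fixedPoint_tower_torus_top`), ‖R′‖ ≤ q < 1, ‖G′₀‖ ≤ C₀ ⇒
  G′ = G′₀∘(1 − R′)⁻¹ and ‖G′‖ ≤ C₀(1 − q)⁻¹.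
* §4 THE TORUS (`parametrix_l2_tower_torus_top`): for the k-fold tower operator Δ′ on `UT N` with the b05 partition of unity
  at scale M₀ (uniform block weights, top level on), GIVEN the two overlap numbers ν₀ (M₀-balls `chiBall`) and ν (output regions
  χ_out with the output-support property of the remainder terms) and M₀ > √(νν₀)·C_rem:
  Δ′⁻¹ = G′₀∘(1 − R′)⁻¹ with ‖Δ′⁻¹‖_{ℓ²} ≤ √(ν₀ν₀)σ_k⁻¹/(1 − √(νν₀)C_rem/M₀) — Thm 3.7-SHAPE in ℓ², uniform in N and U.

WHAT IS NOT HERE (honest scope).  The two COUNTING facts (ν₀ = #centres within M₀ + 1 of a point on the M₀-grid ≤ 3^d-type;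
ν for the output regions) and the OUTPUT-SUPPORT fact of K(h_z)G′_zM_{h_z} (⊂ a neighbourhood of `omegaBall z`) are
HYPOTHESES of §4, named precisely — the geometric half of (3.89); no random-walk EXPANSION (the series Σ_n G′₀R′ⁿ and its
box-walk indexing) is written, only the resolvent form; constants crude and k-dependent (item (v) of the O.2 skeleton); ℓ²
currency.  Row D4: RECORDS value; class of (T3)/NODE O.2 unchanged; D4 DISCHARGE NO DATE; NOT BetaPertH, NOT continuum, NOT Clay.
-/

namespace Summit.QuantumFields.BalabanUV.Beta.CovariantTowerParametrix

open Finset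
open Literature.MathematicalPhysics.QuantumFieldTheory.Balaban1983to89
open B9Thm37Sum B9Thm37Glue B9Thm37GluePU B9Thm37GlueTorusInv B9Thm37GlueTorusCov B9Thm37GlueTorusCovComp
open B9Thm37GlueTorusCovPoinc (tdepth_le card_block_le)
open B9Thm37GlueTorusCovLevels B9Thm37GlueTorusCovLevelsPoinc B9Thm37GlueTorusCovTower B9Thm37GlueTorusCovTowerDir
open B9Thm37GlueTorusCovTowerPU (towerK omegaBall omegaBall_zero_or_one fixedPoint_tower_torus_top)
open Summit.QuantumFields.BalabanUV.Beta.CovariantTowerL2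
open Summit.QuantumFields.BalabanUV.Beta.CovariantTowerRemainder
open B5TorusCover (UT Ctr ctrU)
open B5SmoothPartition (hSU)

noncomputable section

/-! ## §1  Finite overlap: ‖Σ_z S_z‖ ≤ C·√(νν₀) -/

section Overlap

variable {X ι : Type} [Fintype X] [Fintype ι]

/-- Cauchy–Schwarz against a {0,1}-weight: if a_z = 0 whenever χ_z = 0 (χ {0,1}-valued) then
(Σ_z a_z)² ≤ (Σ_z χ_z)·Σ_z a_z². [folklore] -/
theorem sq_sum_le_count_mul_sum_sq (a χ : ι → ℝ) (hχ : ∀ z, χ z = 0 ∨ χ z = 1) (ha : ∀ z, χ z = 0 → a z = 0) :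
    (∑ z, a z) ^ 2 ≤ (∑ z, χ z) * ∑ z, a z ^ 2 := by
  have hprod : ∀ z, a z = χ z * a z := fun z => by
    rcases hχ z with h | h
    · rw [ha z h, mul_zero]
    · rw [h, one_mul]
  have hχsq : ∀ z, χ z ^ 2 = χ z := fun z => by rcases hχ z with h | h <;> simp [h]
  calc (∑ z, a z) ^ 2 = (∑ z, χ z * a z) ^ 2 := by rw [Finset.sum_congr rfl fun z _ => hprod z]
    _ ≤ (∑ z, χ z ^ 2) * ∑ z, a z ^ 2 := Finset.sum_mul_sq_le_sq_mul_sq univ χ a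
    _ = (∑ z, χ z) * ∑ z, a z ^ 2 := by rw [Finset.sum_congr rfl fun z _ => hχsq z]

/-- **FINITE-OVERLAP ALMOST-ORTHOGONALITY (MODEL bookkeeping for the box sums of (3.87)/(3.89)).**  S_z (z ∈ ι) endomorphisms
of the fields on X with: S_z∘M_{χ_in z} = S_z (S_z reads only In(z) = {χ_in z = 1}); (S_z v)(p) = 0 whenever χ_out z p = 0
(writes only Out(z)); ‖S_z‖ ≤ C (C ≥ 0); χ_in, χ_out {0,1}-valued with Σ_z χ_in z p ≤ ν₀ and Σ_z χ_out z p ≤ ν for every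
p (ν, ν₀ ≥ 0).  Then ‖Σ_z S_z‖ ≤ C·√(νν₀). [folklore] -/
theorem l2Bound_sum_of_overlap (S : ι → Module.End ℝ (X → ℝ)) (χin χout : ι → X → ℝ)
    (hin01 : ∀ z p, χin z p = 0 ∨ χin z p = 1) (hout01 : ∀ z p, χout z p = 0 ∨ χout z p = 1)
    (hin : ∀ z, S z * mulOp (χin z) = S z) (hout : ∀ z v p, χout z p = 0 → S z v p = 0)
    {C : ℝ} (hC : 0 ≤ C) (hS : ∀ z, L2Bound (S z) C) {ν₀ ν : ℝ} (hν₀0 : 0 ≤ ν₀) (hν0 : 0 ≤ ν)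
    (hν₀ : ∀ p, ∑ z, χin z p ≤ ν₀) (hν : ∀ p, ∑ z, χout z p ≤ ν) :
    L2Bound (∑ z, S z) (C * Real.sqrt (ν * ν₀)) := by
  refine ⟨mul_nonneg hC (Real.sqrt_nonneg _), fun v => ?_⟩
  -- output side: pointwise Cauchy–Schwarz against χ_out
  have step1 : ∀ p, (∑ z, S z v p) ^ 2 ≤ ν * ∑ z, S z v p ^ 2 := fun p =>
    (sq_sum_le_count_mul_sum_sq (fun z => S z v p) (fun z => χout z p) (fun z => hout01 z p)
      (fun z hz => hout z v p hz)).trans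
      (mul_le_mul_of_nonneg_right (hν p) (Finset.sum_nonneg fun z _ => sq_nonneg _))
  have step2 : ∑ p, (∑ z, S z) v p ^ 2 ≤ ν * ∑ z, ∑ p, S z v p ^ 2 := by
    calc ∑ p, (∑ z, S z) v p ^ 2 = ∑ p, (∑ z, S z v p) ^ 2 := by
          simp only [LinearMap.sum_apply, Finset.sum_apply]
      _ ≤ ∑ p, ν * ∑ z, S z v p ^ 2 := Finset.sum_le_sum fun p _ => step1 p
      _ = ν * ∑ z, ∑ p, S z v p ^ 2 := by rw [← Finset.mul_sum, Finset.sum_comm]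
  -- input side: S_z reads only χ_in z
  have step3 : ∀ z, ∑ p, S z v p ^ 2 ≤ C ^ 2 * ∑ p, (χin z p * v p) ^ 2 := fun z => by
    have e : S z v = S z (mulOp (χin z) v) := by
      conv_lhs => rw [← hin z]
      rfl
    rw [e]
    have h := (hS z).2 (mulOp (χin z) v)
    simpa only [mulOp_apply] using h
  have step4 : ∑ z, ∑ p, (χin z p * v p) ^ 2 ≤ ν₀ * ∑ p, v p ^ 2 := by
    rw [Finset.sum_comm, Finset.mul_sum]
    refine Finset.sum_le_sum fun p _ => ?_
    have hsq : ∀ z, (χin z p * v p) ^ 2 = χin z p * v p ^ 2 := fun z => by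
      rcases hin01 z p with h | h <;> simp [h]
    rw [Finset.sum_congr rfl fun z _ => hsq z, ← Finset.sum_mul]
    exact mul_le_mul_of_nonneg_right (hν₀ p) (sq_nonneg _)
  calc ∑ p, (∑ z, S z) v p ^ 2 ≤ ν * ∑ z, ∑ p, S z v p ^ 2 := step2
    _ ≤ ν * ∑ z, C ^ 2 * ∑ p, (χin z p * v p) ^ 2 :=
        mul_le_mul_of_nonneg_left (Finset.sum_le_sum fun z _ => step3 z) hν0
    _ = ν * C ^ 2 * ∑ z, ∑ p, (χin z p * v p) ^ 2 := by rw [← Finset.mul_sum]; ring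
    _ ≤ ν * C ^ 2 * (ν₀ * ∑ p, v p ^ 2) := mul_le_mul_of_nonneg_left step4 (by positivity)
    _ = (C * Real.sqrt (ν * ν₀)) ^ 2 * ∑ p, v p ^ 2 := by
        rw [mul_pow, Real.sq_sqrt (mul_nonneg hν0 hν₀0)]; ring

end Overlap

/-! ## §2  The inverse of 1 − R in ℓ² for ‖R‖ ≤ q < 1 -/

section Neumann

variable {X : Type} [Fintype X]

/-- **1 − R is a unit when ‖R‖ ≤ q < 1** (finite dimension: injectivity suffices; (1 − R)v = 0 ⇒ ‖v‖ = ‖Rv‖ ≤ q‖v‖ ⇒ v = 0).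
[folklore] -/
theorem isUnit_one_sub {R : Module.End ℝ (X → ℝ)} {q : ℝ} (hR : L2Bound R q) (hq : q < 1) : IsUnit (1 - R) := by
  rw [LinearMap.isUnit_iff_ker_eq_bot, LinearMap.ker_eq_bot']
  intro v hv
  have h0 : v - R v = 0 := hv
  have hRv : R v = v := (sub_eq_zero.mp h0).symm
  have h := hR.2 v
  rw [hRv] at h
  have hS0 : 0 ≤ ∑ x, v x ^ 2 := Finset.sum_nonneg fun x _ => sq_nonneg _
  have hq0 : 0 ≤ q := hR.1
  have hq2 : q ^ 2 < 1 := by nlinarith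
  have hzero : ∑ x, v x ^ 2 = 0 := by nlinarith
  funext x
  have hx := (Finset.sum_eq_zero_iff_of_nonneg fun y _ => sq_nonneg (v y)).mp hzero x (mem_univ x)
  exact pow_eq_zero_iff two_ne_zero |>.mp hx

/-- The a-priori bound: w − Rw = v with ‖R‖ ≤ q < 1 ⇒ Σ w² ≤ (1 − q)⁻²·Σ v². [folklore] -/
theorem sq_le_of_sub_eq {R : Module.End ℝ (X → ℝ)} {q : ℝ} (hR : L2Bound R q) (hq : q < 1) (v w : X → ℝ)
    (hwv : w - R w = v) : ∑ x, w x ^ 2 ≤ (1 - q)⁻¹ ^ 2 * ∑ x, v x ^ 2 := by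
  have h1q : 0 < 1 - q := by linarith
  have hS0 : 0 ≤ ∑ x, w x ^ 2 := Finset.sum_nonneg fun x _ => sq_nonneg _
  have hV0 : 0 ≤ ∑ x, v x ^ 2 := Finset.sum_nonneg fun x _ => sq_nonneg _
  have ha0 : 0 ≤ Real.sqrt (∑ x, w x ^ 2) := Real.sqrt_nonneg _
  have hb0 : 0 ≤ Real.sqrt (∑ x, v x ^ 2) := Real.sqrt_nonneg _
  have hRw : Real.sqrt (∑ x, R w x ^ 2) ≤ q * Real.sqrt (∑ x, w x ^ 2) := by
    rw [← Real.sqrt_sq hR.1, ← Real.sqrt_mul (sq_nonneg _)]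
    exact Real.sqrt_le_sqrt (hR.2 w)
  have e : ∀ x, v x + R w x = w x := fun x => by
    have := congrFun hwv x
    simp only [Pi.sub_apply] at this
    linarith
  have hsum : ∑ x, w x ^ 2 ≤ (Real.sqrt (∑ x, v x ^ 2) + q * Real.sqrt (∑ x, w x ^ 2)) ^ 2 := by
    calc ∑ x, w x ^ 2 = ∑ x, (v x + R w x) ^ 2 := Finset.sum_congr rfl fun x _ => by rw [e x]
      _ ≤ (Real.sqrt (∑ x, v x ^ 2) + Real.sqrt (∑ x, R w x ^ 2)) ^ 2 := L2Bound.sum_add_sq_le _ _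
      _ ≤ (Real.sqrt (∑ x, v x ^ 2) + q * Real.sqrt (∑ x, w x ^ 2)) ^ 2 :=
          pow_le_pow_left₀ (add_nonneg hb0 (Real.sqrt_nonneg _)) (add_le_add le_rfl hRw) 2
  have hqa : 0 ≤ Real.sqrt (∑ x, v x ^ 2) + q * Real.sqrt (∑ x, w x ^ 2) := add_nonneg hb0 (mul_nonneg hR.1 ha0)
  have hab : Real.sqrt (∑ x, w x ^ 2) ≤ Real.sqrt (∑ x, v x ^ 2) + q * Real.sqrt (∑ x, w x ^ 2) := by
    have h := Real.sqrt_le_sqrt hsum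
    rw [Real.sqrt_sq hqa] at h
    exact h
  have ha' : Real.sqrt (∑ x, w x ^ 2) ≤ (1 - q)⁻¹ * Real.sqrt (∑ x, v x ^ 2) := by
    rw [inv_mul_eq_div, le_div_iff₀ h1q]
    nlinarith
  calc ∑ x, w x ^ 2 = Real.sqrt (∑ x, w x ^ 2) ^ 2 := (Real.sq_sqrt hS0).symm
    _ ≤ ((1 - q)⁻¹ * Real.sqrt (∑ x, v x ^ 2)) ^ 2 := pow_le_pow_left₀ ha0 ha' 2
    _ = (1 - q)⁻¹ ^ 2 * ∑ x, v x ^ 2 := by rw [mul_pow, Real.sq_sqrt hV0]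

/-- **‖(1 − R)⁻¹‖ ≤ (1 − q)⁻¹ for ‖R‖ ≤ q < 1** (a-priori bound ‖w‖ ≤ ‖v‖ + q‖w‖ for w = (1 − R)⁻¹v; no series).
[folklore] -/
theorem l2Bound_inverse_one_sub {R : Module.End ℝ (X → ℝ)} {q : ℝ} (hR : L2Bound R q) (hq : q < 1) :
    L2Bound (Ring.inverse (1 - R)) (1 - q)⁻¹ := by
  have hU := isUnit_one_sub hR hq
  refine ⟨inv_nonneg.mpr (by linarith), fun v => sq_le_of_sub_eq hR hq v _ ?_⟩
  have h := LinearMap.congr_fun (Ring.mul_inverse_cancel _ hU) v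
  rw [Module.End.mul_apply, LinearMap.sub_apply] at h
  exact h

/-! ## §3  The parametrix in ℓ²: G′ = G′₀(1 − R′)⁻¹, ‖G′‖ ≤ ‖G′₀‖/(1 − q) -/

/-- **THM 3.7-SHAPE IN ℓ² (abstract)**: from the (3.90)-shape identity G′ = G′₀ + G′R′ (pv21 `fixedPoint_of_388` /
`fixedPoint_tower_torus_top`), ‖R′‖ ≤ q < 1 and ‖G′₀‖ ≤ C₀:  G′ = G′₀∘(1 − R′)⁻¹ and ‖G′‖ ≤ C₀·(1 − q)⁻¹. [folklore] -/
theorem parametrix_l2 {G G0 R : Module.End ℝ (X → ℝ)} (hfix : G = G0 + G * R) {q C0 : ℝ} (hR : L2Bound R q)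
    (hq : q < 1) (hG0 : L2Bound G0 C0) :
    G = G0 * Ring.inverse (1 - R) ∧ L2Bound G (C0 * (1 - q)⁻¹) := by
  have hU := isUnit_one_sub hR hq
  have h1 : G * (1 - R) = G0 := by
    rw [mul_sub, mul_one]
    exact sub_eq_of_eq_add hfix
  have hG : G = G0 * Ring.inverse (1 - R) := by
    calc G = G * ((1 - R) * Ring.inverse (1 - R)) := by rw [Ring.mul_inverse_cancel _ hU, mul_one]
      _ = G0 * Ring.inverse (1 - R) := by rw [← mul_assoc, h1]
  refine ⟨hG, ?_⟩
  rw [hG]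
  exact hG0.comp (l2Bound_inverse_one_sub hR hq)

end Neumann

/-! ## §4  The torus: Thm 3.7-shape in ℓ² for the tower operator, modulo the two overlap numbers and the output
support of the remainder terms -/

section Torus

variable {d : ℕ} {N : Fin d → ℕ} [∀ i, NeZero (N i)] [NeZero d]

omit [NeZero d] in
/-- `chiBall` vanishes only at distance ≥ M₀ + 1 from the centre, where h_z vanishes too. [folklore] -/
theorem hSU_eq_zero_of_chiBall_eq_zero {M₀ : ℕ} (hM₀ : 1 ≤ M₀) (z : Ctr N M₀) (x : UT N)
    (hx : chiBall N M₀ z x = 0) : hSU N M₀ z x = 0 := by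
  unfold chiBall at hx
  split_ifs at hx with h
  · exact absurd hx one_ne_zero
  · exact B9Thm37GluePU.hSU_eq_zero_of_far hM₀ (by linarith [not_lt.mp h])

omit [∀ i, NeZero (N i)] [NeZero d] in
/-- C_rem ≥ 0. [folklore] -/
theorem remConstTower_nonneg (d : ℕ) (M : ℕ → ℕ) {amin wmin : ℝ} (hamin : 0 < amin) (hwmin : 0 < wmin)
    (cmin cmax wmax : ℝ) (k : ℕ) {a : Fin (k + 1) → ℝ} (ha : ∀ l, 0 ≤ a l) :
    0 ≤ remConstTower d M amin wmin cmin cmax wmax k a := by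
  unfold remConstTower
  have hσ := sigmaTowerTorus_pos d M cmin k hamin hwmin
  refine mul_nonneg (mul_nonneg (by positivity) (add_nonneg (by positivity)
    (mul_nonneg (by positivity) (Finset.sum_nonneg fun l _ => ?_)))) (inv_nonneg.mpr hσ.le)
  have := ha l
  positivity

/-- **THM 3.7-SHAPE IN ℓ² FOR THE k-FOLD COVARIANT TOWER OPERATOR ON THE TORUS, MODULO THE OVERLAP NUMBERS (MODEL).**
Δ′ = Δ_U + Σ_{l≤k} a_lG_lᵀG_l on `UT N` (cube-comb tower of sides M_j ∣ N_i; uniform block weights ω_l with a_k ≥ a_min > 0,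
|ω_k| ≥ w_min > 0; every isometric transport; c_min ≤ |c| ≤ c_max), the b05 partition of unity h_z at scale M₀ (1 ≤ M₀,
M₀ ∣ N_i, 2M₀ ≤ N_i), G′_z the Dirichlet inverses on the block hulls Ω₀(z) = `omegaBall`, G′₀ = Σ_z h_zG′_zh_z, R′ = Σ_z
K(h_z)G′_zh_z (pv21 `fixedPoint_tower_torus_top`: Δ′⁻¹ = G′₀ + Δ′⁻¹R′).  HYPOTHESES (the geometric half, named): ν₀ ≥ the
number of M₀-balls `chiBall` through any point; {0,1}-valued output regions χ_out z containing the output support of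
K(h_z)G′_zh_z, at most ν through any point; and M₀ large: q := C_rem·√(νν₀)/M₀ < 1 (C_rem = `remConstTower`).  THEN
Δ′⁻¹ = G′₀∘(1 − R′)⁻¹ and ‖Δ′⁻¹‖_{ℓ²} ≤ σ_k⁻¹√(ν₀ν₀)·(1 − q)⁻¹ — constants independent of N and U. [folklore] -/
theorem parametrix_l2_tower_torus_top {Cp : Type} [Fintype Cp] [DecidableEq Cp] {M : ℕ → ℕ} (hM : ∀ j, 1 ≤ M j)
    (hdiv : ∀ j i, M j ∣ N i) (c : UT N × Fin d → ℝ) {cmin cmax : ℝ} (hcmin : 0 < cmin) (hc : ∀ b, cmin ≤ |c b|)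
    (hc' : ∀ b, |c b| ≤ cmax) (Rm : UT N × Fin d → Cp → Cp → ℝ)
    (hRm : ∀ b i j, ∑ k, Rm b k i * Rm b k j = if i = j then (1 : ℝ) else 0) (k : ℕ) (ω : Fin (k + 1) → ℝ)
    {wmax : ℝ} (hw' : ∀ l, |ω l| ≤ wmax) {a : Fin (k + 1) → ℝ} (ha : ∀ l, 0 ≤ a l) {amin wmin : ℝ}
    (hamin : 0 < amin) (hwmin : 0 < wmin) (hak : amin ≤ a (Fin.last k)) (hωk : wmin ≤ |ω (Fin.last k)|)
    {M₀ : ℕ} (hM₀ : 1 ≤ M₀) (hdiv₀ : ∀ i, M₀ ∣ N i) (h2N : ∀ i, 2 * M₀ ≤ N i)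
    {ν₀ ν : ℝ} (hν₀0 : 0 ≤ ν₀) (hν0 : 0 ≤ ν)
    (hcount₀ : ∀ p : UT N × Cp, ∑ z : Ctr N M₀, chiBall N M₀ z p.1 ≤ ν₀)
    (χout : Ctr N M₀ → UT N × Cp → ℝ) (hout01 : ∀ z p, χout z p = 0 ∨ χout z p = 1)
    (hcount : ∀ p, ∑ z, χout z p ≤ ν)
    (hsupp : ∀ z v p, χout z p = 0 →
      (towerK (torusTower hM hdiv) Rm c k (fun l _ => ω l) a (hSU N M₀ z) *
        dirInv (towerOp (torusTower hM hdiv) Rm c k (fun l _ => ω l) a) (omegaBall hM hdiv k M₀ z ∘ Prod.fst) *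
        mulOp (hSU N M₀ z ∘ Prod.fst) : Module.End ℝ (UT N × Cp → ℝ)) v p = 0)
    (hlarge : remConstTower d M amin wmin cmin cmax wmax k a / M₀ * Real.sqrt (ν * ν₀) < 1) :
    Ring.inverse (towerOp (torusTower hM hdiv) Rm c k (fun l _ => ω l) a) =
        (∑ z : Ctr N M₀, mulOp (hSU N M₀ z ∘ Prod.fst) *
            dirInv (towerOp (torusTower hM hdiv) Rm c k (fun l _ => ω l) a) (omegaBall hM hdiv k M₀ z ∘ Prod.fst) *
            mulOp (hSU N M₀ z ∘ Prod.fst)) *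
          Ring.inverse (1 - ∑ z : Ctr N M₀, towerK (torusTower hM hdiv) Rm c k (fun l _ => ω l) a (hSU N M₀ z) *
            dirInv (towerOp (torusTower hM hdiv) Rm c k (fun l _ => ω l) a) (omegaBall hM hdiv k M₀ z ∘ Prod.fst) *
            mulOp (hSU N M₀ z ∘ Prod.fst)) ∧
      L2Bound (Ring.inverse (towerOp (torusTower hM hdiv) Rm c k (fun l _ => ω l) a))
        ((sigmaTowerTorus d M amin wmin cmin k)⁻¹ * Real.sqrt (ν₀ * ν₀) *
          (1 - remConstTower d M amin wmin cmin cmax wmax k a / M₀ * Real.sqrt (ν * ν₀))⁻¹) := by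
  set Δ' := towerOp (torusTower hM hdiv) Rm c k (fun l _ => ω l) a with hΔ'
  set Gz : Ctr N M₀ → Module.End ℝ (UT N × Cp → ℝ) := fun z =>
    dirInv Δ' (omegaBall hM hdiv k M₀ z ∘ Prod.fst) with hGz
  set Mh : Ctr N M₀ → Module.End ℝ (UT N × Cp → ℝ) := fun z => mulOp (hSU N M₀ z ∘ Prod.fst) with hMh
  set T : Ctr N M₀ → Module.End ℝ (UT N × Cp → ℝ) := fun z => Mh z * Gz z * Mh z with hT
  set S : Ctr N M₀ → Module.End ℝ (UT N × Cp → ℝ) := fun z =>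
    towerK (torusTower hM hdiv) Rm c k (fun l _ => ω l) a (hSU N M₀ z) * Gz z * Mh z with hS
  set χin : Ctr N M₀ → UT N × Cp → ℝ := fun z p => chiBall N M₀ z p.1 with hχin
  have hcov : ∀ (z : Ctr N M₀) (x : UT N) (i : Cp), (omegaBall hM hdiv k M₀ z ∘ Prod.fst) (x, i) = 1 →
      ∃ l : Fin (k + 1), amin ≤ a l ∧ wmin ≤ |(fun (l : Fin (k + 1)) (_ : UT N) => ω l) l
        (towerBlk (torusTower hM hdiv) (l : ℕ) x)| := fun _ _ _ _ => ⟨Fin.last k, hak, hωk⟩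
  have hσ := sigmaTowerTorus_pos d M cmin k hamin hwmin
  -- the fixed-point identity (pv21)
  have hfix : Ring.inverse Δ' = (∑ z, T z) + Ring.inverse Δ' * ∑ z, S z :=
    fixedPoint_tower_torus_top hM hdiv hRm hcmin hc k ω ha hamin hwmin hak hωk hM₀ hdiv₀ h2N
  -- input localisation: M_{h_z} = M_{h_z}·M_{χin z}
  have hMχ : ∀ z, Mh z * mulOp (χin z) = Mh z := fun z =>
    mulOp_mul_mulOp_of_mul_eq fun p => hSU_mul_eq_of_one hM₀ z (fun _ hx => chiBall_eq_one M₀ z _ hx) p.1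
  have hin01 : ∀ z p, χin z p = 0 ∨ χin z p = 1 := fun z p => chiBall_zero_or_one M₀ z p.1
  have hinS : ∀ z, S z * mulOp (χin z) = S z := fun z => by
    simp only [hS]; rw [mul_assoc, hMχ z]
  have hinT : ∀ z, T z * mulOp (χin z) = T z := fun z => by
    simp only [hT]; rw [mul_assoc, hMχ z]
  -- output localisation of the G′₀-terms: inside the M₀-ball
  have houtT : ∀ z v p, χin z p = 0 → T z v p = 0 := fun z v p hp => by
    simp only [hT, hMh, Module.End.mul_apply, mulOp_apply, Function.comp_apply]
    rw [hSU_eq_zero_of_chiBall_eq_zero hM₀ z p.1 hp, zero_mul]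
  -- per-box bounds
  have hSz : ∀ z, L2Bound (S z) (remConstTower d M amin wmin cmin cmax wmax k a / M₀) := fun z =>
    remainderTerm_le_torus_top hM hdiv c hcmin hc hc' Rm hRm k ω hw' ha hamin hwmin hak hωk
      (fun p => omegaBall_zero_or_one hM hdiv k M₀ z p.1) hM₀ z
  have hTz : ∀ z, L2Bound (T z) (1 * (sigmaTowerTorus d M amin wmin cmin k)⁻¹ * 1) := fun z => by
    have hG := l2Bound_dirInv_tower (torusTower hM hdiv) Rm hRm hcmin hc (fun j x => tdepth_le (hM j) x)
      (fun j β => card_block_le (hM j) (hdiv j) β) k (fun l _ => ω l) ha hamin hwmin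
      (fun p => omegaBall_zero_or_one hM hdiv k M₀ z p.1) (hcov z)
    have hMz : L2Bound (Mh z) 1 := l2Bound_mulOp zero_le_one fun p => hh_torus M₀ z p.1
    exact (hMz.comp hG).comp hMz
  have hC0 : 0 ≤ remConstTower d M amin wmin cmin cmax wmax k a / M₀ :=
    div_nonneg (remConstTower_nonneg d M hamin hwmin cmin cmax wmax k ha) (Nat.cast_nonneg _)
  -- the two box sums
  have hR : L2Bound (∑ z, S z) (remConstTower d M amin wmin cmin cmax wmax k a / M₀ * Real.sqrt (ν * ν₀)) :=
    l2Bound_sum_of_overlap S χin χout hin01 hout01 hinS hsupp hC0 hSz hν₀0 hν0 hcount₀ hcount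
  have hTz' : ∀ z, L2Bound (T z) (sigmaTowerTorus d M amin wmin cmin k)⁻¹ := fun z =>
    (hTz z).mono (le_of_eq (by ring))
  have hG0 : L2Bound (∑ z, T z) ((sigmaTowerTorus d M amin wmin cmin k)⁻¹ * Real.sqrt (ν₀ * ν₀)) :=
    l2Bound_sum_of_overlap T χin χin hin01 hin01 hinT houtT (inv_nonneg.mpr hσ.le) hTz' hν₀0 hν₀0 hcount₀ hcount₀
  exact parametrix_l2 hfix hR hlarge hG0

end Torus

end

end Summit.QuantumFields.BalabanUV.Beta.CovariantTowerParametrix
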